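import Summits.ResolutionOfSingularities.ResolutionOfSingularities.Theorems.FrobeniusClosingPatchingRelPerfectDepthLegalStepA
import Summits.ResolutionOfSingularities.ResolutionOfSingularities.Theorems.FrobeniusClosingPatchingRelPerfectDepthLegalTraceFactor
import Literature.AlgebraicGeometry.Resolution.TransversalUnionSNC
import Literature.AlgebraicGeometry.Resolution.EtaleVanishingIdeal
import Literature.AlgebraicGeometry.Resolution.StalkIdealLemmas
import Literature.AlgebraicGeometry.Resolution.StrictNormalCrossingsPoints
import Literature.AlgebraicGeometry.Resolution.MarkedIdealsEtale
import Literature.AlgebraicGeometry.Resolution.AlterationsEnlargingZ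
import HarnessLib

/-!
# Crux `PatchingRelPerfect` (stmt-ResolutionOfSingularities-16161), chain W5.2 — T6-E1b residual `LegalScopedDivisorReduction₃`,
# PHASE 2 closer (2b), D7 step 1: THE ORACLE'S ENTRY INVARIANT `Inv₃` FROM STEP A'S END DATA

[OURS · L1 W5.2 · res-D-pv-052 g6 for the (2b) D7 closer, BY NAME from res-L1-w52-lead-1's `ORACLE-HANDOFF.md` (873ae9ed5877222f) §O4
and `PHASE2-STEPB-SPEC.md` §D4 refined] Replaces the role of NO printed item; NOT a statement of the manuscript under review; fact-free.

STEP A (`DepthLegal.HostState.stepA`, res-L1-w52-stub-1) ends with an identification `e : V(D′) ≅ Z₁` of the host with the final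
Cossart–Jannsen–Saito surface, a closed `X₁ ⊆ Z₁` with regular reduced structure, a strict normal crossings divisor `B₁` of `Z₁`
TRANSVERSAL to `X₁` (CJS Def. 4.1), and the bookkeeping `e(Supp T′) ⊆ X₁ ∪ B₁ ⊇`, `e⁻¹ X₁ ⊆ Supp T′` for the trace `T′ = M′|_{V(D′)}`
of the boundary monomial.  The curve-choosing oracle of STEP B (`DepthLegal.curveOracle₃`, …DepthLegalOracle) wants
`Inv₃`: `Supp T′` INSIDE A STRICT NORMAL CROSSINGS DIVISOR OF THE HOST.  This file derives it:

* `IsRsopPart.eq_one_and_exists_of_mul_le_radical_le` — the local algebra of `TransversalUnionSNC` under the WEAKER sandwich hypothesis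
  `(z) · (∏_J w_j) ≤ √(g) ≤ (z)` (`g ≠ 0`): still `r = 1` (Krull) and `(z) ∩ (∏_J w_j) = (z₁ · ∏_J w_j)` is the ideal of the product of a
  part of a regular system of parameters;
* `IsTransversalWith.isStrictNormalCrossingsDivisor_union_of_sandwich` — `X₁ ∪ B₁` is a strict normal crossings divisor as soon as
  every point of `X₁` carries a non-zero germ `g` with `I(X₁ ∪ B₁)_x ≤ √(g) ≤ I(X₁)_x` (here: a generator of the trace, by the two
  bookkeeping inclusions) — the equality form of the tree lemma is not available because exponent-zero exceptional curves lie in `B₁`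
  but not in `Supp T′`;
* `HostState.stalkIdeal_trace_ne_bot_of_curve` — the trace has NON-ZERO principal stalks at every point of the host, WITHOUT integrality
  of the host: a vanishing generator would put the codimension-one generisation `V(z)` of the host inside `Supp M′`, against the curve
  clause `∀ x ∈ Supp D′ ∩ Supp M′, 1 < coheight x` (Krull's principal ideal theorem bounds its coheight by `1`);
* **`HostState.exists_sncd_trace_of_stepA_end`** — `Inv₃`'s first half on `V(D′)`: `BX := e⁻¹(X₁ ∪ B₁)`.

AI-written; AI review is weaker than expert review.

## References
* V. Cossart, U. Jannsen, S. Saito, LNM 2270 (2020), Def. 4.1, Thm. 1.4. [CossartJannsenSaito2020]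
* V. Cossart, O. Piltant, J. Algebra 529 (2019) = arXiv:1412.0868v1, §4.1 (paragraph after Prop. 4.4). [CossartPiltant2019]
* H. Matsumura, *Commutative Ring Theory* (1986), Thm. 13.5, 14.2, 17.4. [Matsumura1987]
* The Stacks Project, Tags 00KV, 01J7. [StacksProject]
-/

-- `Summit.<Summit>.<Sub>.Theorems` with `Sub = Summit` (single-conjunct summit, D-0017)
set_option linter.dupNamespace false

noncomputable section

open CategoryTheory CategoryTheory.Limits AlgebraicGeometry TopologicalSpace IsLocalRing
open Literature.AlgebraicGeometry.Resolution Scheme.IdealSheafData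

namespace Summit.ResolutionOfSingularities.ResolutionOfSingularities.Theorems

universe u

namespace DepthLegal

open WeightTwoB DepthTargets

/-! ## §1 Local algebra: the sandwich version of `IsRsopPart.eq_one_and_exists_of_inf_eq_radical` -/

section Ring

variable {R : Type u} [CommRing R] [IsLocalRing R]

/-- [OURS · L1 W5.2] **Sandwich version of the CP 2019 Thm. 1.1 (iii) local algebra.** Let `z₁, …, z_r, w₁, …, w_e` be part of a regular
system of parameters of `R`, `J ⊆ {1, …, e}`, `g ≠ 0` with `(z) · (∏_{j∈J} w_j) ≤ √(g) ≤ (z)`.  Then `r = 1` and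
`(z) ∩ (∏_{j∈J} w_j) = (∏ᵢ xᵢ)` for the part `x = ((w_j)_{j∈J}, z₁)` of a regular system of parameters.  (`r ≥ 1` as `g ≠ 0` lies in
`(z)`; the prime `(z)` is minimal over `(g)` since a smaller prime `Q ⊇ (g)` contains `√(g) ⊇ (z)·∏ w_j` with `∏ w_j ∉ (z) ⊇ Q`; Krull.)
[cite: Matsumura1987, Thm. 13.5, Thm. 17.4 (iii)] [cite: CossartPiltant2019, §4.1] -/
theorem _root_.Literature.AlgebraicGeometry.Resolution.IsRsopPart.eq_one_and_exists_of_mul_le_radical_le {r e : ℕ}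
    {z : Fin r → R} {w : Fin e → R} (hzw : IsRsopPart (Fin.append z w)) (J : Finset (Fin e)) {g : R} (hg : g ≠ 0)
    (hle : Ideal.span (Set.range z) * Ideal.span {∏ j ∈ J, w j} ≤ (Ideal.span {g}).radical)
    (hge : (Ideal.span {g}).radical ≤ Ideal.span (Set.range z)) :
    r = 1 ∧ ∃ x : Fin (J.card + 1) → R, IsRsopPart x ∧
      Ideal.span (Set.range z) ⊓ Ideal.span {∏ j ∈ J, w j} = Ideal.span {∏ i, x i} := by
  classical
  haveI := hzw.isRegularLocalRing
  haveI := isDomain_of_isRegularLocalRing R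
  have hz : IsRsopPart z := hzw.append_left
  set P : Ideal R := Ideal.span (Set.range z) with hPdef
  set F : Ideal R := Ideal.span {∏ j ∈ J, w j} with hFdef
  haveI hP : P.IsPrime := hz.isPrime_span_range
  -- `∏_{j ∈ J} w_j ∉ P`
  have hprodP : ∏ j ∈ J, w j ∉ P := by
    intro hmem
    obtain ⟨j, -, hj⟩ := (Ideal.IsPrime.prod_mem_iff (hp := hP)).mp hmem
    exact hzw.append_right_not_mem_span_range_left j hj
  -- `(g) ≤ P`
  have hgP : Ideal.span {g} ≤ P := Ideal.le_radical.trans hge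
  -- `r ≥ 1`
  have hr1 : 1 ≤ r := by
    by_contra hr0
    have hr0' : r = 0 := by omega
    subst hr0'
    have hP0 : P = ⊥ := by
      rw [hPdef, Set.range_eq_empty, Ideal.span_empty]
    have hgmem : g ∈ P := hgP (Ideal.mem_span_singleton_self g)
    rw [hP0] at hgmem
    exact hg ((Submodule.mem_bot R).mp hgmem)
  -- `P` is a minimal prime of `(g)`
  have hmin : P ∈ (Ideal.span {g}).minimalPrimes := by
    refine ⟨⟨hP, hgP⟩, fun Q hQ hQP => ?_⟩
    haveI : Q.IsPrime := hQ.1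
    have hradQ : (Ideal.span {g}).radical ≤ Q := (Ideal.IsPrime.radical_le_iff hQ.1).mpr hQ.2
    have hPFQ : P * F ≤ Q := hle.trans hradQ
    rcases (Ideal.IsPrime.mul_le (hp := hQ.1)).mp hPFQ with hPQ | hFQ
    · exact hPQ
    · exact absurd (hQP (hFQ (Ideal.mem_span_singleton_self _))) hprodP
  -- Krull: `ht P ≤ 1`, while `ht P = r`
  have hheight : P.height ≤ 1 :=
    Ideal.height_le_one_of_isPrincipal_of_mem_minimalPrimes (Ideal.span {g}) P hmin
  rw [hPdef, hz.height_span_range] at hheight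
  have hr : r = 1 := le_antisymm (by exact_mod_cast hheight) hr1
  subst hr
  refine ⟨rfl, ?_⟩
  -- the part `x = ((w_j)_{j∈J}, z₁)` of a regular system of parameters
  let w' : Fin J.card → R := w ∘ J.orderEmbOfFin rfl
  let ι : Fin (J.card + 1) → Fin (1 + e) :=
    Fin.append (Fin.natAdd 1 ∘ J.orderEmbOfFin rfl) (Fin.castAdd e)
  have hι : Function.Injective ι := by
    intro a b hab
    induction a using Fin.addCases with
    | left a =>
      induction b using Fin.addCases with
      | left b =>
        simp only [ι, Fin.append_left, Function.comp_apply] at hab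
        exact congrArg (Fin.castAdd 1) ((J.orderEmbOfFin rfl).injective (Fin.natAdd_injective _ _ hab))
      | right b =>
        simp only [ι, Fin.append_left, Fin.append_right, Function.comp_apply] at hab
        have h1 := congrArg Fin.val hab
        rw [Fin.val_natAdd, Fin.val_castAdd] at h1
        have h2 := b.2
        omega
    | right a =>
      induction b using Fin.addCases with
      | left b =>
        simp only [ι, Fin.append_left, Fin.append_right, Function.comp_apply] at hab
        have h1 := congrArg Fin.val hab
        rw [Fin.val_natAdd, Fin.val_castAdd] at h1
        have h2 := a.2
        omega
      | right b =>
        simp only [ι, Fin.append_right] at hab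
        exact congrArg (Fin.natAdd J.card) (Fin.castAdd_injective _ _ hab)
  have hcomp : Fin.append z w ∘ ι = Fin.append w' z := by
    funext a
    induction a using Fin.addCases with
    | left a => simp [ι, w']
    | right a => simp [ι]
  have hx : IsRsopPart (Fin.append w' z) := hcomp ▸ hzw.comp ι hι
  refine ⟨Fin.append w' z, hx, ?_⟩
  -- `∏_{j∈J} w_j = ∏_k w'_k`
  have hprod : ∏ k, w' k = ∏ j ∈ J, w j := by
    rw [← Finset.prod_coe_sort J w]
    exact Fintype.prod_equiv (J.orderIsoOfFin rfl).toEquiv _ _ fun k => by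
      simp [w', Finset.coe_orderIsoOfFin_apply]
  -- `(∏ w') ∩ (z₁) = (∏ w') · (z₁) = (∏ w' · z₁)`
  have hz0 : Set.range z = {z 0} := by
    rw [Set.range_unique]
    rfl
  calc Ideal.span (Set.range z) ⊓ Ideal.span {∏ j ∈ J, w j}
      = Ideal.span {∏ k, w' k} ⊓ Ideal.span (Set.range z) := by rw [hprod, inf_comm]
    _ = Ideal.span {∏ k, w' k} * Ideal.span (Set.range z) := hx.span_prod_inf_span_range
    _ = Ideal.span {(∏ k, w' k) * z 0} := by
        rw [hz0, Ideal.span_singleton_mul_span_singleton]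
    _ = Ideal.span {∏ i, Fin.append w' z i} := by
        rw [Fin.prod_univ_add]
        simp

end Ring

/-! ## §2 The union of a transversal pair is a strict normal crossings divisor (sandwich version) -/

/-- [OURS · L1 W5.2] **`D ∪ B` is a strict normal crossings divisor — sandwich version of
`IsTransversalWith.isStrictNormalCrossingsDivisor_union`**: for `D` closed and transversal with the strict normal crossings divisor `B`
(CJS Def. 4.1), it suffices that every point `x ∈ D` carries a non-zero germ `g` with `I(D ∪ B)_x ≤ √(g) ≤ I(D)_x` (e.g. a generator of an
ideal whose support `S` satisfies `D ⊆ S ⊆ D ∪ B`). [cite: CossartJannsenSaito2020, Def. 4.1] [cite: CossartPiltant2019, §4.1] -/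
theorem _root_.Literature.AlgebraicGeometry.Resolution.IsTransversalWith.isStrictNormalCrossingsDivisor_union_of_sandwich
    {Z : Scheme.{u}} {D B : Set Z} (htr : IsTransversalWith Z D B) (hB : IsStrictNormalCrossingsDivisor Z B) (hD : IsClosed D)
    (hrad : ∀ x ∈ D, ∃ g : Z.presheaf.stalk x, g ≠ 0 ∧
      stalkIdeal (vanishingIdeal ⟨closure (D ∪ B), isClosed_closure⟩) x ≤ (Ideal.span {g}).radical ∧
      (Ideal.span {g}).radical ≤ stalkIdeal (vanishingIdeal ⟨closure D, isClosed_closure⟩) x) :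
    IsStrictNormalCrossingsDivisor Z (D ∪ B) := by
  classical
  have hBc : IsClosed B := hB.isClosed
  rw [isStrictNormalCrossingsDivisor_iff_stalkIdeal] at hB ⊢
  refine ⟨hD.union hBc, fun p hp => ?_⟩
  -- the ideal of `D ∪ B` is `I(D) ∩ I(B)`, stalkwise
  have hclos : (⟨closure (D ∪ B), isClosed_closure⟩ : Closeds Z) =
      (⟨closure D, isClosed_closure⟩ : Closeds Z) ⊔ ⟨closure B, isClosed_closure⟩ := by
    apply Closeds.ext
    simp [closure_union]
  have hinf : stalkIdeal (vanishingIdeal ⟨closure (D ∪ B), isClosed_closure⟩) p =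
      stalkIdeal (vanishingIdeal ⟨closure D, isClosed_closure⟩) p ⊓
        stalkIdeal (vanishingIdeal ⟨closure B, isClosed_closure⟩) p := by
    rw [hclos, vanishingIdeal_sup, stalkIdeal_inf]
  by_cases hpD : p ∈ D
  · -- at a point of `D`: the transversal parameters
    obtain ⟨hreg, r, e, z, w, J, hdim, hspan, hDp, hBp⟩ := htr p hpD
    obtain ⟨g, hg, hle, hge⟩ := hrad p hpD
    have hzw : IsRsopPart (Fin.append z w) := by
      refine ⟨hreg, 0, Fin.elim0, by simpa using hdim, ?_⟩
      rw [range_fin_append, Set.range_eq_empty Fin.elim0, Set.union_empty, hspan]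
    rw [hinf, hDp, hBp] at hle
    rw [hDp] at hge
    obtain ⟨-, x, hx, hx'⟩ := hzw.eq_one_and_exists_of_mul_le_radical_le J hg (Ideal.mul_le_inf.trans hle) hge
    obtain ⟨-, e', y, hdim', hspan'⟩ := hx
    refine ⟨hreg, J.card + 1, e', x, y, by omega, hdim', hspan', ?_⟩
    rw [hinf, hDp, hBp, hx']
  · -- off `D`: the picture of `B`
    have hpB : p ∈ B := hp.resolve_left hpD
    obtain ⟨hreg, r, e, x, y, hr, hdim, hspan, hBp⟩ := hB.2 p hpB
    refine ⟨hreg, r, e, x, y, hr, hdim, hspan, ?_⟩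
    have htop : stalkIdeal (vanishingIdeal ⟨closure D, isClosed_closure⟩) p = ⊤ := by
      apply stalkIdeal_eq_top_of_not_mem_support
      rw [← SetLike.mem_coe, Scheme.IdealSheafData.coe_support_vanishingIdeal]
      change p ∉ closure D
      rwa [hD.closure_eq]
    rw [hinf, htop, top_inf_eq, hBp]

/-! ## §3 The trace has non-zero stalks (curve clause instead of integrality) -/

namespace HostState

variable {E : Scheme.{u}} [IsLocallyNoetherian E] {H D : E.IdealSheafData} {L : List (E.IdealSheafData × ℕ)}
  (S : HostState H D L)

include S in
/-- [OURS · L1 W5.2] **The trace of the boundary monomial on the host has PRINCIPAL NON-ZERO stalks**, at every point of the host, as soon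
as no codimension-one point of the host lies in `Supp M` (the curve clause): if the generator `g` of `M_{ιx}` died on the host, i.e.
`g ∈ (z) = D_{ιx}`, the generisation `ξ` of `ι x` with prime `(z)` would lie in `Supp D ∩ Supp M` with `coheight ξ = ht (z) ≤ 1` (Krull).
[cite: StacksProject, Tag 00KV] [cite: StacksProject, Tag 01J7] -/
theorem exists_stalkIdeal_trace_eq_span_of_curve
    (hcurve : ∀ x ∈ D.support, x ∈ (monomialIdeal L).support → 1 < Order.coheight x) (x : D.subscheme) :
    ∃ t : D.subscheme.presheaf.stalk x, stalkIdeal ((monomialIdeal L).comap D.subschemeι) x = Ideal.span {t} ∧ t ≠ 0 := by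
  haveI : IsRegularLocalRing (E.presheaf.stalk (D.subschemeι x)) := S.regE _
  obtain ⟨g, hg, -, -⟩ := exists_generator_stalkIdeal_monomialIdeal L (x := D.subschemeι x)
    (fun p hp hxp => S.sncB.exists_generator_of_mem (fst_mem_boundaryOf hp) hxp)
  refine ⟨(D.subschemeι.stalkMap x).hom g, ?_, fun h0 => ?_⟩
  · rw [stalkIdeal_comap_eq_map, hg, Ideal.map_span, Set.image_singleton]
  -- `g ∈ ker ι^♯_x = (z)`
  obtain ⟨z, hDx, hz2⟩ := S.hostHyp (D.subschemeι x) (subschemeι_apply_mem_support D x)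
  have hker : RingHom.ker (D.subschemeι.stalkMap x).hom = Ideal.span {z} := by rw [ker_stalkMap_subschemeι, hDx]
  have hgz : g ∈ Ideal.span {z} := by rw [← hker]; exact h0
  have hzm : z ∈ maximalIdeal (E.presheaf.stalk (D.subschemeι x)) :=
    (Ideal.span_singleton_le_iff_mem _).mp (hDx ▸ (mem_support_iff_stalkIdeal_le D _).mp (subschemeι_apply_mem_support D x))
  -- `(z)` is prime (`𝒪/(z)` is regular, hence a domain)
  haveI hprime : (Ideal.span {z}).IsPrime := by
    haveI := (IsRegularLocalRing.quotient_span_singleton hzm hz2).1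
    haveI := isDomain_of_isRegularLocalRing (E.presheaf.stalk (D.subschemeι x) ⧸ Ideal.span {z})
    exact (Ideal.Quotient.isDomain_iff_prime _).mp inferInstance
  -- the generisation `ξ` with prime `(z)`
  let 𝔮 : PrimeSpectrum (E.presheaf.stalk (D.subschemeι x)) := ⟨Ideal.span {z}, hprime⟩
  have hξ : E.fromSpecStalk (D.subschemeι x) 𝔮 ⤳ D.subschemeι x := fromSpecStalk_specializes 𝔮
  have h𝔭 : primeOfSpecializes hξ = Ideal.span {z} := primeOfSpecializes_fromSpecStalk 𝔮
  have hξD : E.fromSpecStalk (D.subschemeι x) 𝔮 ∈ D.support := by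
    rw [mem_support_iff_stalkIdeal_le_primeOfSpecializes hξ, h𝔭, hDx]
  have hξM : E.fromSpecStalk (D.subschemeι x) 𝔮 ∈ (monomialIdeal L).support := by
    rw [mem_support_iff_stalkIdeal_le_primeOfSpecializes hξ, h𝔭, hg, Ideal.span_singleton_le_iff_mem]
    exact hgz
  -- `coheight ξ = ht (z) ≤ 1`
  have hmin : Ideal.span {z} ∈ (Ideal.span {z}).minimalPrimes := by
    rw [Ideal.minimalPrimes_eq_subsingleton_self]; exact Set.mem_singleton _
  have hht : (Ideal.span {z}).height ≤ 1 := Ideal.height_le_one_of_isPrincipal_of_mem_minimalPrimes _ _ hmin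
  have hco : Order.coheight (E.fromSpecStalk (D.subschemeι x) 𝔮) ≤ 1 := by
    have h := coe_height_primeOfSpecializes hξ
    rw [h𝔭] at h
    have h' : ((Order.coheight (E.fromSpecStalk (D.subschemeι x) 𝔮) : WithBot ℕ∞)) ≤ ((1 : ℕ∞) : WithBot ℕ∞) := by
      rw [← h]; exact_mod_cast hht
    exact_mod_cast h'
  exact absurd (hcurve _ hξD hξM) (not_lt.mpr hco)

/-! ## §4 `Inv₃` at the end of STEP A -/

include S in
/-- [OURS · L1 W5.2] **THE ORACLE'S ENTRY INVARIANT from STEP A's end data.** With `e : V(D) ≅ Z₁`, `X₁ ⊆ Z₁` closed, `B₁` a strict normal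
crossings divisor of `Z₁` transversal to `X₁`, `e(Supp T) ⊆ X₁ ∪ B₁` and `e⁻¹ X₁ ⊆ Supp T` for the trace `T = M|_{V(D)}` (whose stalks are
non-zero by the curve clause), the trace lies in the strict normal crossings divisor `BX := e⁻¹(X₁ ∪ B₁)` of the host.
[cite: CossartJannsenSaito2020, Def. 4.1, Thm. 1.4] [cite: CossartPiltant2019, §4.1] -/
theorem exists_sncd_trace_of_stepA_end
    (hcurve : ∀ x ∈ D.support, x ∈ (monomialIdeal L).support → 1 < Order.coheight x)
    {Z₁ : Scheme.{u}} [IsNoetherian Z₁] (e : D.subscheme ≅ Z₁) {X₁ B₁ : Set Z₁} (hX₁c : IsClosed X₁)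
    (hB₁ : IsStrictNormalCrossingsDivisor Z₁ B₁) (htr : IsTransversalWith Z₁ X₁ B₁)
    (hU : ∀ x : D.subscheme, x ∈ (((monomialIdeal L).comap D.subschemeι).support : Set D.subscheme) → e.hom x ∈ X₁ ∪ B₁)
    (hL : ∀ z : Z₁, z ∈ X₁ → e.inv z ∈ (((monomialIdeal L).comap D.subschemeι).support : Set D.subscheme)) :
    ∃ BX : Set D.subscheme, IsStrictNormalCrossingsDivisor D.subscheme BX ∧
      (((monomialIdeal L).comap D.subschemeι).support : Set D.subscheme) ⊆ BX := by
  -- the trace pushed to `Z₁`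
  set T := (monomialIdeal L).comap D.subschemeι with hT
  set T₁ : Z₁.IdealSheafData := T.comap e.inv with hT₁
  have hsuppT₁ : ∀ z : Z₁, z ∈ (T₁.support : Set Z₁) ↔ e.inv z ∈ (T.support : Set D.subscheme) := fun z =>
    mem_support_comap_iff e.inv T z
  -- UPPER / LOWER on `Z₁`
  have hup : (T₁.support : Set Z₁) ⊆ X₁ ∪ B₁ := by
    intro z hz
    have h := hU (e.inv z) ((hsuppT₁ z).mp hz)
    rwa [← Scheme.Hom.comp_apply, Iso.inv_hom_id] at h
  have hlow : X₁ ⊆ (T₁.support : Set Z₁) := fun z hz => (hsuppT₁ z).mpr (hL z hz)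
  -- the sandwich at the points of `X₁`
  have hsnc : IsStrictNormalCrossingsDivisor Z₁ (X₁ ∪ B₁) := by
    refine htr.isStrictNormalCrossingsDivisor_union_of_sandwich hB₁ hX₁c fun z hz => ?_
    obtain ⟨t, ht, ht0⟩ := S.exists_stalkIdeal_trace_eq_span_of_curve hcurve (e.inv z)
    -- the generator of `T₁` at `z`
    have hT₁z : stalkIdeal T₁ z = Ideal.span {(e.inv.stalkMap z).hom t} := by
      rw [hT₁, stalkIdeal_comap_eq_map, ht, Ideal.map_span, Set.image_singleton]
    haveI : IsIso (e.inv.stalkMap z) := inferInstance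
    have hg0 : (e.inv.stalkMap z).hom t ≠ 0 := by
      intro h0
      apply ht0
      have hinj : Function.Injective (e.inv.stalkMap z).hom :=
        (ConcreteCategory.bijective_of_isIso (e.inv.stalkMap z)).1
      exact hinj (by rw [h0, map_zero])
    refine ⟨(e.inv.stalkMap z).hom t, hg0, ?_, ?_⟩
    · -- `I(X₁ ∪ B₁)_z ≤ I(Supp T₁)_z = √(T₁)_z`
      have h1 : vanishingIdeal ⟨closure (X₁ ∪ B₁), isClosed_closure⟩ ≤ vanishingIdeal T₁.support := by
        refine Scheme.IdealSheafData.le_support_iff_le_vanishingIdeal.mp (SetLike.coe_subset_coe.mp ?_)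
        rw [Scheme.IdealSheafData.coe_support_vanishingIdeal]
        exact hup.trans subset_closure
      have h2 := stalkIdeal_mono h1 z
      rwa [vanishingIdeal_support, stalkIdeal_radical, hT₁z] at h2
    · -- `√(T₁)_z = I(Supp T₁)_z ≤ I(X₁)_z`
      have h1 : vanishingIdeal T₁.support ≤ vanishingIdeal ⟨closure X₁, isClosed_closure⟩ := by
        refine Scheme.IdealSheafData.le_support_iff_le_vanishingIdeal.mp (SetLike.coe_subset_coe.mp ?_)
        rw [Scheme.IdealSheafData.coe_support_vanishingIdeal]
        change closure X₁ ⊆ (T₁.support : Set Z₁)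
        rw [hX₁c.closure_eq]
        exact hlow
      have h2 := stalkIdeal_mono h1 z
      rwa [vanishingIdeal_support, stalkIdeal_radical, hT₁z] at h2
  -- pull back along the isomorphism `e`
  refine ⟨e.hom ⁻¹' (X₁ ∪ B₁), hsnc.preimage_of_etale e.hom, fun x hx => hU x hx⟩

end HostState

end DepthLegal

end Summit.ResolutionOfSingularities.ResolutionOfSingularities.Theorems

end
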